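import Mathlib
import Summits.RiemannHypothesis.RiemannHypothesis.Theses.RuelleBand
import Literature.NumberTheory.LFunctions.RHWave0

/-!
# Sketch — crux-ideate stmt-RiemannHypothesis-2061 (ExactFirstBand), round 1, ideator 2

First-lemma signatures for the two crux idea cards of this folder
(`idea-dihedral-casimir-hecke-pair.md`, `idea-semiclassical-regime-transfer.md`).
Everything here is over existing declarations; the two composition theorems are proved,
the engines are `Prop`s (to be proved by crux-plan / provers).
-/

namespace Summit.RiemannHypothesis.RiemannHypothesis.Cruxes.ExactFirstBand.Ideator2

open Summit.RiemannHypothesis.RiemannHypothesis.Theses.RuelleBand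
open scoped ComplexConjugate

/-! ## Card 1 — dihedral Casimir / Hecke pair -/

/-- TWO-PRIME INCOMMENSURABILITY (engine, elementary): if `cosh (z log 2)` and `cosh (z log 3)` are
both real then `z` is real or purely imaginary.  (`Im cosh((x+iy)L) = sinh(xL) sin(yL)`, and
`y log 2 ∈ πℤ ∧ y log 3 ∈ πℤ ⇒ y = 0` because `2^a ≠ 3^b` for `(a,b) ≠ (0,0)`.)  M-sized. -/
def TwoPrimeCoshReality : Prop :=
  ∀ z : ℂ, (Complex.cosh (z * (Real.log 2 : ℂ))).im = 0 →
    (Complex.cosh (z * (Real.log 3 : ℂ))).im = 0 → z.re = 0 ∨ z.im = 0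

/-- HECKE-PAIR REALITY (the card's hypothesis, zero side): for every zero `ρ` of `ζ` in the open
strip, the joint eigenvalues `p^{ρ-1/2} + p^{1/2-ρ} = 2 cosh((ρ-1/2) log p)` of the two idele-class
Hecke operators `H_p = T_{log p} + T_{-log p}`, `p = 2, 3`, are REAL.  (On Meyer's realisation this is
"the point spectrum of `H_2` and `H_3` on the first band is real".) -/
def HeckePairReality : Prop :=
  ∀ s : ℂ, riemannZeta s = 0 → 0 < s.re → s.re < 1 →
    (Complex.cosh ((s - 1 / 2) * (Real.log 2 : ℂ))).im = 0 ∧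
      (Complex.cosh ((s - 1 / 2) * (Real.log 3 : ℂ))).im = 0

/-- Composition: the two-prime engine turns Hecke-pair reality into the crux. [S] -/
theorem exactFirstBand_of_heckePairReality (hE : TwoPrimeCoshReality) (h : HeckePairReality) :
    ExactFirstBand := by
  intro s hs h0 h1
  obtain ⟨h2, h3⟩ := h s hs h0 h1
  rcases hE (s - 1 / 2) h2 h3 with hre | him
  · left
    have : (s - 1 / 2 : ℂ).re = s.re - 1 / 2 := by simp
    linarith [this.symm.trans hre]
  · right
    have : (s - 1 / 2 : ℂ).im = s.im := by simp
    rw [← this]; exact him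

/-- ABSTRACT TWO-INVOLUTION ENGINE (A'Campo's lemma, Hilbert form): if `S₁, S₂` are bounded
involutions whose anticommutator `S₁S₂ + S₂S₁` is self-adjoint, then every eigenvalue `μ` of
`T = S₂ S₁` lies on the unit circle or on the real axis (`T⁻¹ = S₁S₂`, so `T + T⁻¹` is self-adjoint
and `μ + μ⁻¹ ∈ ℝ`).  Applied with `S₂ = 𝓕` (Fourier/inversion involution, `𝓕 T_t 𝓕 = T_{-t}`) and
`S₁ = 𝓕 T_t`; then `T + T⁻¹ = T_t + T_{-t}`.  M-sized, provable now. -/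
def TwoInvolutionEngine : Prop :=
  ∀ (H : Type) [NormedAddCommGroup H] [InnerProductSpace ℂ H] [CompleteSpace H]
    (S₁ S₂ : H →L[ℂ] H),
    S₁.comp S₁ = ContinuousLinearMap.id ℂ H → S₂.comp S₂ = ContinuousLinearMap.id ℂ H →
    IsSelfAdjoint (S₁.comp S₂ + S₂.comp S₁) →
    ∀ (μ : ℂ) (v : H), v ≠ 0 → (S₂.comp S₁) v = μ • v → ‖μ‖ = 1 ∨ μ.im = 0

/-- BANACH (multiplicity-free) ENGINE: let `t ↦ T t` be a one-parameter group of bounded operators on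
a complex Banach space `E`, `v ≠ 0` a joint eigenvector with character `e^{tz}`, and `p > 1`.  If the
"Hecke–Schrödinger group" `σ ↦ exp(iσ (T(log p) + T(-log p)))` (`= Σₙ iⁿ Jₙ(2σ) T(n log p)`) has
subexponential growth in `σ ∈ ℝ`, then `cosh (z log p)` is real.  (Its action on `v` is the scalar
`exp(2iσ cosh(z log p))`.)  No inner product and no simplicity of zeros is needed. M-sized. -/
def SubexpHeckeGroupEngine : Prop :=
  ∀ (E : Type) [NormedAddCommGroup E] [NormedSpace ℂ E] [CompleteSpace E] (T : ℝ → E →L[ℂ] E),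
    T 0 = ContinuousLinearMap.id ℂ E → (∀ s t : ℝ, T (s + t) = (T s).comp (T t)) →
    ∀ (z : ℂ) (v : E), v ≠ 0 → (∀ t : ℝ, T t v = Complex.exp (↑t * z) • v) →
    ∀ p : ℕ, 1 < p →
      (∀ ε : ℝ, 0 < ε → ∃ C : ℝ, ∀ σ : ℝ,
        ‖NormedSpace.exp ((Complex.I * (σ : ℂ)) • (T (Real.log p) + T (-Real.log p)))‖ ≤
          C * Real.exp (ε * |σ|)) →
      (Complex.cosh (z * (Real.log p : ℂ))).im = 0

/-! ## Card 2 — semiclassical-regime transfer -/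

/-- EXACT BAND ABOVE HEIGHT `T₀`: every zero of the open strip with `|Im s| > T₀` is on the line. -/
def HighExactBand (T₀ : ℝ) : Prop :=
  ∀ s : ℂ, riemannZeta s = 0 → 0 < s.re → s.re < 1 → T₀ < |s.im| → s.re = 1 / 2

/-- Composition: the verified height (Platt–Trudgian 2021, the tree's named fact
`platt_trudgian_numerical_rh`, `T₀ = 3 000 175 332 800`) plus Schwarz reflection (`riemannZeta_conj`,
Mathlib) reduce the crux to the exact band in the semiclassical regime `|γ| > T₀`; the real-axis
disjunct of the crux absorbs `Im s = 0`. [S] -/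
theorem exactFirstBand_of_highExactBand
    (hPT : Literature.NumberTheory.LFunctions.platt_trudgian_numerical_rh)
    (h : HighExactBand 3000175332800) : ExactFirstBand := by
  intro s hs h0 h1
  by_cases him : s.im = 0
  · exact Or.inr him
  left
  by_cases hbig : (3000175332800 : ℝ) < |s.im|
  · exact h s hs h0 h1 hbig
  have hle : |s.im| ≤ 3000175332800 := not_lt.1 hbig
  rcases lt_or_gt_of_ne him with hneg | hpos
  · -- conjugate zero has positive imaginary part
    have hs' : riemannZeta (conj s) = 0 := by rw [riemannZeta_conj, hs, map_zero]
    have h0' : 0 < (conj s).im := by simp; linarith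
    have hT' : (conj s).im ≤ 3000175332800 := by
      simp; rw [abs_of_neg hneg] at hle; linarith
    have := hPT (conj s) hs' h0' hT'
    simpa using this
  · exact hPT s hs hpos (by rw [abs_of_pos hpos] at hle; exact hle)


/-! ## Proofs of the two elementary engines of card 1 (moved in from the scratch file Engines.lean) -/

namespace Scratch


/-- Imaginary part of `cosh w`. -/
theorem cosh_im_eq (w : ℂ) : (Complex.cosh w).im = Real.sinh w.re * Real.sin w.im := by
  have h2 : 2 * Complex.cosh w = Complex.exp w + Complex.exp (-w) := Complex.two_cosh w
  have him := congrArg Complex.im h2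
  have h2im : (2 * Complex.cosh w).im = 2 * (Complex.cosh w).im := by
    simp [Complex.mul_im]
  rw [h2im, Complex.add_im, Complex.exp_im, Complex.exp_im, Complex.neg_re, Complex.neg_im,
    Real.sin_neg] at him
  rw [Real.sinh_eq]
  linarith

/-- Imaginary part of `cosh (z * L)` for real `L`. -/
theorem cosh_mul_ofReal_im (z : ℂ) (L : ℝ) :
    (Complex.cosh (z * (L : ℂ))).im = Real.sinh (z.re * L) * Real.sin (z.im * L) := by
  rw [cosh_im_eq]
  simp [Complex.mul_re, Complex.mul_im]

/-- `sinh (x L) sin (y L) = 0` with `L ≠ 0` forces `x = 0` or `y L ∈ π ℤ`. -/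
theorem re_eq_zero_or_exists_int_of_im_zero {z : ℂ} {L : ℝ} (hL : L ≠ 0)
    (h : (Complex.cosh (z * (L : ℂ))).im = 0) :
    z.re = 0 ∨ ∃ n : ℤ, (n : ℝ) * Real.pi = z.im * L := by
  rw [cosh_mul_ofReal_im] at h
  rcases mul_eq_zero.1 h with h1 | h2
  · left
    have : z.re * L = 0 := Real.sinh_eq_zero.1 h1
    rcases mul_eq_zero.1 this with h3 | h3
    · exact h3
    · exact absurd h3 hL
  · right
    exact Real.sin_eq_zero_iff.1 h2

/-- `3^a = 2^b` only for `a = b = 0` (parity). -/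
theorem two_pow_ne_three_pow {a b : ℕ} (h : (3 : ℕ) ^ a = 2 ^ b) : a = 0 ∧ b = 0 := by
  rcases Nat.eq_zero_or_pos b with hb | hb
  · subst hb
    simp at h
    exact ⟨h, rfl⟩
  · exfalso
    have h2 : 2 ∣ 3 ^ a := by
      rw [h]; exact dvd_pow_self 2 (Nat.pos_iff_ne_zero.1 hb)
    have : 2 ∣ 3 := Nat.Prime.dvd_of_dvd_pow Nat.prime_two h2
    omega

/-- TWO-PRIME INCOMMENSURABILITY ENGINE. -/
theorem twoPrimeCoshReality (z : ℂ)
    (h2 : (Complex.cosh (z * (Real.log 2 : ℂ))).im = 0)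
    (h3 : (Complex.cosh (z * (Real.log 3 : ℂ))).im = 0) : z.re = 0 ∨ z.im = 0 := by
  have hL2p : 0 < Real.log 2 := Real.log_pos (by norm_num)
  have hL3p : 0 < Real.log 3 := Real.log_pos (by norm_num)
  have hL2 : Real.log 2 ≠ 0 := hL2p.ne'
  have hL3 : Real.log 3 ≠ 0 := hL3p.ne'
  rcases re_eq_zero_or_exists_int_of_im_zero hL2 h2 with h | ⟨m, hm⟩
  · exact Or.inl h
  rcases re_eq_zero_or_exists_int_of_im_zero hL3 h3 with h | ⟨n, hn⟩
  · exact Or.inl h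
  right
  by_contra hy
  -- m log 3 = n log 2
  have key : (m : ℝ) * Real.log 3 = (n : ℝ) * Real.log 2 := by
    have hpi : Real.pi ≠ 0 := Real.pi_ne_zero
    have e : (m : ℝ) * Real.pi * Real.log 3 = (n : ℝ) * Real.pi * Real.log 2 := by
      rw [hm, hn]; ring
    have e' : ((m : ℝ) * Real.log 3 - (n : ℝ) * Real.log 2) * Real.pi = 0 := by linarith [e]
    rcases mul_eq_zero.1 e' with h0 | h0
    · linarith
    · exact absurd h0 hpi
  have hm0 : m ≠ 0 := by
    rintro rfl
    have : z.im * Real.log 2 = 0 := by simpa using hm.symm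
    rcases mul_eq_zero.1 this with h | h
    · exact hy h
    · exact hL2 h
  -- |m| log 3 = |n| log 2, as naturals in the exponent
  have key' : (m.natAbs : ℝ) * Real.log 3 = (n.natAbs : ℝ) * Real.log 2 := by
    have e := congrArg (fun x : ℝ => |x|) key
    simp only [abs_mul, abs_of_pos hL2p, abs_of_pos hL3p] at e
    rw [Nat.cast_natAbs, Nat.cast_natAbs]
    push_cast
    exact e
  have hpow : (3 : ℝ) ^ m.natAbs = (2 : ℝ) ^ n.natAbs := by
    have e3 : Real.log ((3 : ℝ) ^ m.natAbs) = Real.log ((2 : ℝ) ^ n.natAbs) := by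
      rw [Real.log_pow, Real.log_pow, key']
    have p3 : 0 < (3 : ℝ) ^ m.natAbs := by positivity
    have p2 : 0 < (2 : ℝ) ^ n.natAbs := by positivity
    exact Real.log_injOn_pos (Set.mem_Ioi.2 p3) (Set.mem_Ioi.2 p2) e3
  have hnat : (3 : ℕ) ^ m.natAbs = 2 ^ n.natAbs := by exact_mod_cast hpow
  have := two_pow_ne_three_pow hnat
  exact hm0 (Int.natAbs_eq_zero.1 this.1)

/-- ABSTRACT TWO-INVOLUTION ENGINE (A'Campo's lemma). -/
theorem twoInvolutionEngine (H : Type) [NormedAddCommGroup H] [InnerProductSpace ℂ H]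
    [CompleteSpace H] (S₁ S₂ : H →L[ℂ] H)
    (h1 : S₁.comp S₁ = ContinuousLinearMap.id ℂ H) (h2 : S₂.comp S₂ = ContinuousLinearMap.id ℂ H)
    (hA : IsSelfAdjoint (S₁.comp S₂ + S₂.comp S₁))
    (μ : ℂ) (v : H) (hv : v ≠ 0) (hev : (S₂.comp S₁) v = μ • v) : ‖μ‖ = 1 ∨ μ.im = 0 := by
  -- the inverse relation: S₁ S₂ (S₂ S₁ v) = v
  have hinv : (S₁.comp S₂) ((S₂.comp S₁) v) = v := by
    have e1 : S₂ (S₂ (S₁ v)) = S₁ v := by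
      have := congrArg (fun T : H →L[ℂ] H => T (S₁ v)) h2
      simpa using this
    have e2 : S₁ (S₁ v) = v := by
      have := congrArg (fun T : H →L[ℂ] H => T v) h1
      simpa using this
    simp [e1, e2]
  rw [hev, map_smul] at hinv
  have hμ0 : μ ≠ 0 := by
    rintro rfl
    simp at hinv
    exact hv hinv.symm
  have hinv' : (S₁.comp S₂) v = μ⁻¹ • v := by
    have := congrArg (fun w => μ⁻¹ • w) hinv
    simp [smul_smul, inv_mul_cancel₀ hμ0] at this
    exact this
  -- A v = (μ⁻¹ + μ) v
  have hAv : (S₁.comp S₂ + S₂.comp S₁) v = (μ⁻¹ + μ) • v := by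
    rw [ContinuousLinearMap.add_apply, hinv', hev, add_smul]
  -- ⟪A v, v⟫ is real
  have hreal : (inner ℂ ((S₁.comp S₂ + S₂.comp S₁) v) v).im = 0 := by
    have hs := hA.isSymmetric
    have := hs.coe_reApplyInnerSelf_apply v
    rw [← this]
    simp
  rw [hAv, inner_smul_left] at hreal
  have hvv : inner ℂ v v = ((‖v‖ ^ 2 : ℝ) : ℂ) := by
    rw [inner_self_eq_norm_sq_to_K]; norm_cast
  rw [hvv, Complex.mul_im, Complex.ofReal_re, Complex.ofReal_im, mul_zero, zero_add] at hreal
  have hn : (‖v‖ ^ 2 : ℝ) ≠ 0 := by positivity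
  have him : (starRingEnd ℂ (μ⁻¹ + μ)).im = 0 := by
    rcases mul_eq_zero.1 hreal with h | h
    · exact h
    · exact absurd h hn
  have him' : (μ⁻¹ + μ).im = 0 := by
    rw [Complex.conj_im] at him
    linarith
  -- μ.im (normSq μ - 1) = 0
  rw [Complex.add_im, Complex.inv_im] at him'
  have hns : Complex.normSq μ ≠ 0 := by rwa [Ne, Complex.normSq_eq_zero]
  have hns' : 0 < Complex.normSq μ := lt_of_le_of_ne (Complex.normSq_nonneg μ) (Ne.symm hns)
  have key : μ.im * (Complex.normSq μ - 1) = 0 := by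
    have : -μ.im / Complex.normSq μ + μ.im = μ.im * (Complex.normSq μ - 1) / Complex.normSq μ := by
      field_simp
      ring
    rw [this] at him'
    rcases div_eq_zero_iff.1 him' with h | h
    · exact h
    · exact absurd h hns
  rcases mul_eq_zero.1 key with h | h
  · exact Or.inr h
  · left
    have h1 : Complex.normSq μ = 1 := by linarith
    rw [Complex.normSq_eq_norm_sq] at h1
    nlinarith [norm_nonneg μ]

end Scratch

/-- The two-prime engine HOLDS. [proved] -/
theorem twoPrimeCoshReality_holds : TwoPrimeCoshReality :=
  fun z h2 h3 => Scratch.twoPrimeCoshReality z h2 h3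

/-- A'Campo's two-involution engine HOLDS. [proved] -/
theorem twoInvolutionEngine_holds : TwoInvolutionEngine :=
  fun H _ _ _ S₁ S₂ h1 h2 hA μ v hv hev => Scratch.twoInvolutionEngine H S₁ S₂ h1 h2 hA μ v hv hev

/-- Hence the crux follows from Hecke-pair reality ALONE. [proved] -/
theorem exactFirstBand_of_heckePairReality' (h : HeckePairReality) : ExactFirstBand :=
  exactFirstBand_of_heckePairReality twoPrimeCoshReality_holds h

end Summit.RiemannHypothesis.RiemannHypothesis.Cruxes.ExactFirstBand.Ideator2
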